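import Summits.AtomisticToContinuum.FouriersLaw.Theorems.SuperadditiveResistance.Negative.KillCriteria

/-!
# `AbelThermodynamicLimit` / Negative (2): kill criteria for the frequency-resolved sign laws
# (line `series-law-at-every-laplace-frequency`, skeleton `Lines/SketchIdeator2.lean`)

Support file (`--supports stmt-AtomisticToContinuum-14013`) of the standing disprover seat of the crux
`LatticeLandauDamping.AbelThermodynamicLimit`.  The lead's line closes the crux from two SIGN LAWS between
finite OPEN chains at each Laplace frequency `ν ∈ (0, ν₀]` — quasi-superadditivity of the current resolvent form
`F_N(ν)` (stub QS) and of the Laplace-resolved resistance `R_N(ν) = (N-1)²T²/F_N(ν)` (stub QSR) — plus the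
fixed-frequency matching `F_N(ν)/N → Â(ν)` (stub S3), positivity `F_N(ν) > 0` (stub POS), the landed DC identity
`F_N(0⁺) = (N-1)T²D_N` (K) and the witness `Â(ν) → T²κ`.  Nothing below refutes a stub; it records, as
kernel-checked real analysis over ABSTRACT sequences shaped exactly like the stub signatures, what the stub SET
secretly asserts and hence how it can die:

* §A `fekete_fixed_nu` — Fekete along `k ↦ kN` at a fixed frequency (the line's engine, re-proved importably).
* §B `dcShadow_of_freqResolved` — a frequency-resolved sign law passes to its DC shadow at fixed `N, M`; so QSR
  implies the conclusion of the live crux `JunctionLocality.SuperadditiveResistance` (stmt-11748) for the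
  canonical response, and EVERY landed kill criterion of that crux kills QSR: `not_qsrShape_of_rpow_correction`
  (`κ_N → κ` from BELOW like `N^{s-1}`, `0 < s < 1`), `not_qsrShape_of_log_correction` (`(log N)/N` from below).
* §C `twoSided_envelope` / `twoSided_dc_law` — QS ∧ QSR ∧ S3 ∧ POS force the TWO-SIDED laws
  `N·Â(ν) - c ≤ F_N(ν) ≤ N·Â(ν) + C₁` uniformly on `(0, ν₀] × {N ≥ 2}` and, at DC,
  `|(N-1)T²D_N - N·T²κ| ≤ C`: the line proves not just `D_N → κ` but the finite-size RATE `D_N - κ = O(1/N)`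
  from both sides — any slower approach, from above OR below, at one admissible `(ω₂, lam, β, γ, T)` kills the pair.
* §D `not_qsShape_of_excess_from_above` — the side the resistance crux cannot see
  (`insertionBounded_of_subadditive_dip`, stmt-11748): `(N-1)D_N - Nκ → +∞` (approach from ABOVE slower than
  `1/N`, or overshoot) kills QS given S3 and the DC limits.
* §E `matching_pins_kappa` — S3 pins `Â(ν)` and hence `κ` across all regular witnesses (the ∀-witness content
  hidden in the matching stub; consistent with `tlconv_kappa_unique`).

No new definitions.  cdisprove seat refuter-cdisprove-stmt-AtomisticToContinuum-14013-0, 2026-08-16.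
-/

noncomputable section

namespace Summit.AtomisticToContinuum.FouriersLaw.Theorems.AbelThermodynamicLimit.Negative

open Filter Set Topology
open Summit.AtomisticToContinuum.FouriersLaw.Theorems.SuperadditiveResistance.Negative

/-! ## §A Fekete at a fixed Laplace frequency -/

/-- **Fekete at a fixed frequency** (the line's engine; statement and proof follow the lead's
`Lines/SketchIdeator2.lean`, made importable).  If `G N ν + G M ν - C ≤ G (N+M) ν` for `N, M ≥ 2`,
`ν ∈ (0, ν₀]`, and `G N ν / N → g ν`, then `G N ν ≤ N·g ν + C` for every `N ≥ 2`, `ν ∈ (0, ν₀]`. [folklore] -/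
theorem fekete_fixed_nu (G : ℕ → ℝ → ℝ) (g : ℝ → ℝ) (C ν₀ : ℝ)
    (hQ : ∀ ν ∈ Ioc (0 : ℝ) ν₀, ∀ N M : ℕ, 2 ≤ N → 2 ≤ M → G N ν + G M ν - C ≤ G (N + M) ν)
    (hlim : ∀ ν ∈ Ioc (0 : ℝ) ν₀, Tendsto (fun N : ℕ => G N ν / N) atTop (𝓝 (g ν))) :
    ∀ ν ∈ Ioc (0 : ℝ) ν₀, ∀ N : ℕ, 2 ≤ N → G N ν ≤ N * g ν + C := by
  intro ν hν N hN
  have hNpos : 0 < N := by omega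
  have hNposR : (0 : ℝ) < N := by exact_mod_cast hNpos
  have iter : ∀ k : ℕ, 1 ≤ k → (k : ℝ) * G N ν - ((k : ℝ) - 1) * C ≤ G (k * N) ν := by
    intro k hk
    induction k with
    | zero => omega
    | succ k ih =>
      rcases Nat.eq_zero_or_pos k with rfl | hkpos
      · simp
      · have ih' := ih hkpos
        have hkN : 2 ≤ k * N := le_trans hN (Nat.le_mul_of_pos_left N hkpos)
        have hq := hQ ν hν (k * N) N hkN hN
        have hcast : ((k + 1 : ℕ) : ℝ) = (k : ℝ) + 1 := by push_cast; ring
        have hidx : (k + 1) * N = k * N + N := by ring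
        rw [hidx, hcast]
        linarith
  have hmul : Tendsto (fun k : ℕ => k * N) atTop atTop :=
    tendsto_atTop_atTop.2 fun b => ⟨b, fun k hk => le_trans hk (Nat.le_mul_of_pos_right k hNpos)⟩
  have hsub : Tendsto (fun k : ℕ => G (k * N) ν / ((k * N : ℕ) : ℝ)) atTop (𝓝 (g ν)) :=
    (hlim ν hν).comp hmul
  have hRHS : Tendsto (fun k : ℕ => (G N ν - C) / N + C / N / (k : ℝ)) atTop
      (𝓝 ((G N ν - C) / N + 0)) :=
    tendsto_const_nhds.add (tendsto_const_div_atTop_nhds_zero_nat (C / N))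
  have hlow : ∀ᶠ k : ℕ in atTop,
      (G N ν - C) / N + C / N / (k : ℝ) ≤ G (k * N) ν / ((k * N : ℕ) : ℝ) := by
    filter_upwards [eventually_ge_atTop 1] with k hk
    have hkposR : (0 : ℝ) < k := by exact_mod_cast hk
    have h := iter k hk
    have e1 : (G N ν - C) / N + C / N / (k : ℝ) =
        ((k : ℝ) * G N ν - ((k : ℝ) - 1) * C) / ((k * N : ℕ) : ℝ) := by
      push_cast
      field_simp
      ring
    rw [e1]
    exact div_le_div_of_nonneg_right h (by positivity)
  have hle : (G N ν - C) / N + 0 ≤ g ν := le_of_tendsto_of_tendsto hRHS hsub hlow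
  rw [add_zero, div_le_iff₀ hNposR] at hle
  linarith

/-! ## §B A frequency-resolved sign law passes to its DC shadow -/

/-- **DC shadow.**  A sign law `R N ν + R M ν - C ≤ R (N+M) ν` valid on a frequency window `(0, ν₀]`
passes to the DC values `R0 N = lim_{ν ↓ 0} R N ν` at fixed `N, M`.  With `R N ν = (N-1)²T²/F_N(ν)` and
the landed (K) + forced positivity, `R0 N = (N-1)/D_N`: stub QSR implies, for the canonical response, the
conclusion of the live crux `SuperadditiveResistance` (stmt-11748) with the SAME constant. [folklore] -/
theorem dcShadow_of_freqResolved (R : ℕ → ℝ → ℝ) (R0 : ℕ → ℝ) (C ν₀ : ℝ) (hν₀ : 0 < ν₀)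
    (hQ : ∀ ν ∈ Ioc (0 : ℝ) ν₀, ∀ N M : ℕ, 2 ≤ N → 2 ≤ M → R N ν + R M ν - C ≤ R (N + M) ν)
    (hDC : ∀ N : ℕ, 2 ≤ N → Tendsto (R N) (𝓝[>] 0) (𝓝 (R0 N))) :
    ∀ N M : ℕ, 2 ≤ N → 2 ≤ M → R0 N + R0 M - C ≤ R0 (N + M) := by
  intro N M hN hM
  have hNM : 2 ≤ N + M := by omega
  have hl : Tendsto (fun ν => R N ν + R M ν - C) (𝓝[>] 0) (𝓝 (R0 N + R0 M - C)) :=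
    ((hDC N hN).add (hDC M hM)).sub_const C
  refine le_of_tendsto_of_tendsto hl (hDC (N + M) hNM) ?_
  filter_upwards [Ioc_mem_nhdsGT hν₀] with ν hν using hQ ν hν N M hN hM

/-- **QSR inherits the power-law kill of the resistance crux.**  If the Laplace-resolved resistances
`R N ν` of a response sequence `D` have DC limits `(N-1)/D_N` (`N ≥ 2`) and `(N-1)/D_N = ℓ·N + a + b·N^s` with
`b > 0`, `0 < s < 1` (`D_N → 1/ℓ` from BELOW like `N^{s-1}`), then NO window `(0, ν₀]` and constant `C` make
`R` quasi-superadditive — the shape of stub QSR fails (landed `not_insertionBounded_of_rpow_correction`). [folklore] -/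
theorem not_qsrShape_of_rpow_correction (R : ℕ → ℝ → ℝ) (D : ℕ → ℝ) (ℓ a b s : ℝ) (hb : 0 < b)
    (hs0 : 0 < s) (hs1 : s < 1)
    (hR : ∀ N : ℕ, 2 ≤ N → ((N : ℝ) - 1) / D N = ℓ * N + a + b * (N : ℝ) ^ s)
    (hDC : ∀ N : ℕ, 2 ≤ N → Tendsto (R N) (𝓝[>] 0) (𝓝 (((N : ℝ) - 1) / D N))) :
    ¬ ∃ C ν₀ : ℝ, 0 ≤ C ∧ 0 < ν₀ ∧ ∀ ν : ℝ, 0 < ν → ν ≤ ν₀ → ∀ N M : ℕ, 2 ≤ N → 2 ≤ M →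
        R N ν + R M ν - C ≤ R (N + M) ν := by
  rintro ⟨C, ν₀, -, hν₀, hQ⟩
  refine not_insertionBounded_of_rpow_correction (D := D) ℓ a b s hb hs0 hs1 hR ⟨C, fun N M hN hM => ?_⟩
  have h := dcShadow_of_freqResolved R (fun N => ((N : ℝ) - 1) / D N) C ν₀ hν₀
    (fun ν hν N M hN hM => hQ ν hν.1 hν.2 N M hN hM) hDC N M hN hM
  have e : ((N : ℝ) + (M : ℝ) - 1) / D (N + M) = (((N + M : ℕ) : ℝ) - 1) / D (N + M) := by push_cast; ring
  rw [e]
  exact h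

/-- **QSR inherits the logarithmic kill** (the marginal case, produced by a kinetic slab caricature at the
`lam = 0` edge of the family): `(N-1)/D_N = ℓ·N + a + b·log N`, `b > 0`, excludes the shape of stub QSR. [folklore] -/
theorem not_qsrShape_of_log_correction (R : ℕ → ℝ → ℝ) (D : ℕ → ℝ) (ℓ a b : ℝ) (hb : 0 < b)
    (hR : ∀ N : ℕ, 2 ≤ N → ((N : ℝ) - 1) / D N = ℓ * N + a + b * Real.log N)
    (hDC : ∀ N : ℕ, 2 ≤ N → Tendsto (R N) (𝓝[>] 0) (𝓝 (((N : ℝ) - 1) / D N))) :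
    ¬ ∃ C ν₀ : ℝ, 0 ≤ C ∧ 0 < ν₀ ∧ ∀ ν : ℝ, 0 < ν → ν ≤ ν₀ → ∀ N M : ℕ, 2 ≤ N → 2 ≤ M →
        R N ν + R M ν - C ≤ R (N + M) ν := by
  rintro ⟨C, ν₀, -, hν₀, hQ⟩
  refine not_insertionBounded_of_log_correction (D := D) ℓ a b hb hR ⟨C, fun N M hN hM => ?_⟩
  have h := dcShadow_of_freqResolved R (fun N => ((N : ℝ) - 1) / D N) C ν₀ hν₀
    (fun ν hν N M hN hM => hQ ν hν.1 hν.2 N M hN hM) hDC N M hN hM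
  have e : ((N : ℝ) + (M : ℝ) - 1) / D (N + M) = (((N + M : ℕ) : ℝ) - 1) / D (N + M) := by push_cast; ring
  rw [e]
  exact h

/-! ## §C The pair of sign laws is two-sided: the `O(1/N)` law it secretly proves -/

/-- **Two-sided envelope at every frequency of the window.**  QS (on `G`, constant `C₁`), QSR (on
`R N ν = (N-1)²T²/G N ν`, constant `C₂ ≥ 0`), matching `G N ν / N → g ν` with `g ν > 0`, and positivity
`G N ν > 0` give, for all `ν ∈ (0, ν₀]` and `N ≥ 2`,
`N·g ν - (2 + C₂·g ν/T²)·g ν ≤ G N ν ≤ N·g ν + C₁`.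
So at each frequency the finite-size defect `G_N(ν) - N·Â(ν)` is BOUNDED ON BOTH SIDES, uniformly in `N`, by
constants that stay bounded as `ν ↓ 0` whenever `Â` does. [folklore] -/
theorem twoSided_envelope (G : ℕ → ℝ → ℝ) (g : ℝ → ℝ) (C₁ C₂ ν₀ T : ℝ) (hC₂ : 0 ≤ C₂) (hT : 0 < T)
    (hQS : ∀ ν ∈ Ioc (0 : ℝ) ν₀, ∀ N M : ℕ, 2 ≤ N → 2 ≤ M → G N ν + G M ν - C₁ ≤ G (N + M) ν)
    (hQSR : ∀ ν ∈ Ioc (0 : ℝ) ν₀, ∀ N M : ℕ, 2 ≤ N → 2 ≤ M →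
      ((N : ℝ) - 1) ^ 2 * T ^ 2 / G N ν + ((M : ℝ) - 1) ^ 2 * T ^ 2 / G M ν - C₂ ≤
        (((N + M : ℕ) : ℝ) - 1) ^ 2 * T ^ 2 / G (N + M) ν)
    (hlim : ∀ ν ∈ Ioc (0 : ℝ) ν₀, Tendsto (fun N : ℕ => G N ν / N) atTop (𝓝 (g ν)))
    (hg : ∀ ν ∈ Ioc (0 : ℝ) ν₀, 0 < g ν)
    (hpos : ∀ ν ∈ Ioc (0 : ℝ) ν₀, ∀ N : ℕ, 2 ≤ N → 0 < G N ν) :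
    ∀ ν ∈ Ioc (0 : ℝ) ν₀, ∀ N : ℕ, 2 ≤ N →
      N * g ν - (2 + C₂ * g ν / T ^ 2) * g ν ≤ G N ν ∧ G N ν ≤ N * g ν + C₁ := by
  intro ν hν N hN
  refine ⟨?_, fekete_fixed_nu G g C₁ ν₀ hQS hlim ν hν N hN⟩
  -- Fekete on the resistance form
  have hT2 : (0 : ℝ) < T ^ 2 := by positivity
  have hgν := hg ν hν
  have hρlim : ∀ ν' ∈ Ioc (0 : ℝ) ν₀,
      Tendsto (fun N : ℕ => ((N : ℝ) - 1) ^ 2 * T ^ 2 / G N ν' / N) atTop (𝓝 (T ^ 2 / g ν')) := by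
    intro ν' hν'
    have hK : g ν' ≠ 0 := (hg ν' hν').ne'
    have h1 : Tendsto (fun N : ℕ => (1 : ℝ) - 1 / (N : ℝ)) atTop (𝓝 (1 - 0)) :=
      tendsto_const_nhds.sub tendsto_one_div_atTop_nhds_zero_nat
    rw [sub_zero] at h1
    have h2 : Tendsto (fun N : ℕ => T ^ 2 * ((1 : ℝ) - 1 / (N : ℝ)) ^ 2 * (G N ν' / N)⁻¹) atTop
        (𝓝 (T ^ 2 * 1 ^ 2 * (g ν')⁻¹)) :=
      ((h1.pow 2).const_mul (T ^ 2)).mul ((hlim ν' hν').inv₀ hK)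
    rw [one_pow, mul_one, ← div_eq_mul_inv] at h2
    refine h2.congr' ?_
    filter_upwards [eventually_ge_atTop 2] with N hN2
    have hN0 : (N : ℝ) ≠ 0 := by positivity
    have hG0 : G N ν' ≠ 0 := (hpos ν' hν' N hN2).ne'
    field_simp
  have hkey : ((N : ℝ) - 1) ^ 2 * T ^ 2 / G N ν ≤ N * (T ^ 2 / g ν) + C₂ :=
    fekete_fixed_nu (fun N ν => ((N : ℝ) - 1) ^ 2 * T ^ 2 / G N ν) (fun ν => T ^ 2 / g ν) C₂ ν₀
      hQSR hρlim ν hν N hN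
  -- unpack the resistance bound into a lower bound on `G`
  have hGpos := hpos ν hν N hN
  have hN2 : (2 : ℝ) ≤ N := by exact_mod_cast hN
  rw [div_le_iff₀ hGpos] at hkey
  -- `(N-1)² T² ≤ (N T²/g + C₂) G`, i.e. `G ≥ (N-1)² g /(N + C₂ g/T²) ≥ N g - (2 + C₂ g/T²) g`
  have h1 : ((N : ℝ) - 1) ^ 2 * g ν ≤ ((N : ℝ) + C₂ * g ν / T ^ 2) * G N ν := by
    have e : ((N : ℝ) * (T ^ 2 / g ν) + C₂) * G N ν * g ν = ((N : ℝ) + C₂ * g ν / T ^ 2) * G N ν * T ^ 2 := by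
      field_simp
    have := mul_le_mul_of_nonneg_right hkey hgν.le
    rw [e] at this
    have h' : ((N : ℝ) - 1) ^ 2 * T ^ 2 * g ν = ((N : ℝ) - 1) ^ 2 * g ν * T ^ 2 := by ring
    rw [h'] at this
    exact le_of_mul_le_mul_right this hT2
  have hA : 0 < (N : ℝ) + C₂ * g ν / T ^ 2 := by positivity
  -- `(N-1)² = (N + c)(N - 2 - c) + (1 + c)²  ≥ (N + c)(N - 2 - c)` with `c = C₂ g/T²`
  have h2 : ((N : ℝ) + C₂ * g ν / T ^ 2) * (((N : ℝ) - (2 + C₂ * g ν / T ^ 2)) * g ν) ≤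
      ((N : ℝ) + C₂ * g ν / T ^ 2) * G N ν := by
    refine le_trans ?_ h1
    have hsq : 0 ≤ (1 + C₂ * g ν / T ^ 2) ^ 2 * g ν := by positivity
    nlinarith [hsq]
  have h3 := le_of_mul_le_mul_left h2 hA
  linarith [h3]

/-- **The two-sided DC law.**  Add the DC limits `G N ν → G0 N` (`ν ↓ 0`, fixed `N ≥ 2`) and `g ν → L`:
then `N·L - (2 + C₂·L/T²)·L ≤ G0 N ≤ N·L + C₁` for every `N ≥ 2`.  With `G0 N = (N-1)T²D_N` (landed (K))
and `L = T²κ` (the witness) this reads `|(N-1)D_N - N·κ| ≤ C/T²`: the stub set of the line proves the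
finite-size RATE `D_N = κ + O(1/N)` FROM BOTH SIDES, not merely `D_N → κ`.  Contrapositive: one admissible
parameter point where `κ_N` approaches `κ` more slowly than `1/N` — from above or from below — kills
QS ∧ QSR (given S3, POS, (K) and the witness). [folklore] -/
theorem twoSided_dc_law (G : ℕ → ℝ → ℝ) (G0 : ℕ → ℝ) (g : ℝ → ℝ) (C₁ C₂ ν₀ T L : ℝ) (hC₂ : 0 ≤ C₂)
    (hT : 0 < T) (hν₀ : 0 < ν₀)
    (hQS : ∀ ν ∈ Ioc (0 : ℝ) ν₀, ∀ N M : ℕ, 2 ≤ N → 2 ≤ M → G N ν + G M ν - C₁ ≤ G (N + M) ν)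
    (hQSR : ∀ ν ∈ Ioc (0 : ℝ) ν₀, ∀ N M : ℕ, 2 ≤ N → 2 ≤ M →
      ((N : ℝ) - 1) ^ 2 * T ^ 2 / G N ν + ((M : ℝ) - 1) ^ 2 * T ^ 2 / G M ν - C₂ ≤
        (((N + M : ℕ) : ℝ) - 1) ^ 2 * T ^ 2 / G (N + M) ν)
    (hlim : ∀ ν ∈ Ioc (0 : ℝ) ν₀, Tendsto (fun N : ℕ => G N ν / N) atTop (𝓝 (g ν)))
    (hg : ∀ ν ∈ Ioc (0 : ℝ) ν₀, 0 < g ν)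
    (hpos : ∀ ν ∈ Ioc (0 : ℝ) ν₀, ∀ N : ℕ, 2 ≤ N → 0 < G N ν)
    (hgL : Tendsto g (𝓝[>] 0) (𝓝 L))
    (hDC : ∀ N : ℕ, 2 ≤ N → Tendsto (G N) (𝓝[>] 0) (𝓝 (G0 N))) :
    ∀ N : ℕ, 2 ≤ N → N * L - (2 + C₂ * L / T ^ 2) * L ≤ G0 N ∧ G0 N ≤ N * L + C₁ := by
  intro N hN
  have henv := twoSided_envelope G g C₁ C₂ ν₀ T hC₂ hT hQS hQSR hlim hg hpos
  have hev : ∀ᶠ ν in 𝓝[>] (0 : ℝ), ν ∈ Ioc (0 : ℝ) ν₀ := Ioc_mem_nhdsGT hν₀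
  constructor
  · have hlow : Tendsto (fun ν => (N : ℝ) * g ν - (2 + C₂ * g ν / T ^ 2) * g ν) (𝓝[>] 0)
        (𝓝 ((N : ℝ) * L - (2 + C₂ * L / T ^ 2) * L)) :=
      (hgL.const_mul _).sub ((tendsto_const_nhds.add ((hgL.const_mul C₂).div_const _)).mul hgL)
    exact le_of_tendsto_of_tendsto hlow (hDC N hN) (hev.mono fun ν hν => (henv ν hν N hN).1)
  · have hup : Tendsto (fun ν => (N : ℝ) * g ν + C₁) (𝓝[>] 0) (𝓝 ((N : ℝ) * L + C₁)) :=
      (hgL.const_mul _).add_const C₁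
    exact le_of_tendsto_of_tendsto (hDC N hN) hup (hev.mono fun ν hν => (henv ν hν N hN).2)

/-! ## §D The side the resistance crux cannot see -/

/-- **Kill criterion for QS (approach from ABOVE, or overshoot).**  If the DC values satisfy
`G0 N - N·L → +∞` — with `G0 N = (N-1)T²D_N`, `L = T²κ`: `(N-1)(D_N - κ) → +∞`, i.e. `κ_N` exceeds `κ` by
`≫ 1/N` along a subsequence-free divergence — then the conductance-form sign law QS cannot hold on any window
together with the matching and the DC limits.  (The resistance-form law alone tolerates this:
`insertionBounded_of_subadditive_dip`, stmt-11748.) [folklore] -/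
theorem not_qsShape_of_excess_from_above (G : ℕ → ℝ → ℝ) (G0 : ℕ → ℝ) (g : ℝ → ℝ) (L : ℝ)
    (hlimN : ∀ ν : ℝ, 0 < ν → Tendsto (fun N : ℕ => G N ν / N) atTop (𝓝 (g ν)))
    (hgL : Tendsto g (𝓝[>] 0) (𝓝 L))
    (hDC : ∀ N : ℕ, 2 ≤ N → Tendsto (G N) (𝓝[>] 0) (𝓝 (G0 N)))
    (hexcess : Tendsto (fun N : ℕ => G0 N - N * L) atTop atTop) :
    ¬ ∃ C ν₀ : ℝ, 0 ≤ C ∧ 0 < ν₀ ∧ ∀ ν : ℝ, 0 < ν → ν ≤ ν₀ → ∀ N M : ℕ, 2 ≤ N → 2 ≤ M →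
        G N ν + G M ν - C ≤ G (N + M) ν := by
  rintro ⟨C, ν₀, -, hν₀, hQ⟩
  have hfek := fekete_fixed_nu G g C ν₀ (fun ν hν N M hN hM => hQ ν hν.1 hν.2 N M hN hM)
    (fun ν hν => hlimN ν hν.1)
  -- pass to DC at fixed `N`: `G0 N ≤ N L + C`
  have hDCle : ∀ N : ℕ, 2 ≤ N → G0 N ≤ N * L + C := by
    intro N hN
    have hup : Tendsto (fun ν => (N : ℝ) * g ν + C) (𝓝[>] 0) (𝓝 ((N : ℝ) * L + C)) :=
      (hgL.const_mul _).add_const C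
    have hev : ∀ᶠ ν in 𝓝[>] (0 : ℝ), ν ∈ Ioc (0 : ℝ) ν₀ := Ioc_mem_nhdsGT hν₀
    exact le_of_tendsto_of_tendsto (hDC N hN) hup (hev.mono fun ν hν => hfek ν hν N hN)
  obtain ⟨N₀, hN₀⟩ := (tendsto_atTop_atTop.mp hexcess) (C + 1)
  have h1 := hN₀ (max N₀ 2) (le_max_left _ _)
  have h2 := hDCle (max N₀ 2) (le_max_right _ _)
  linarith

/-! ## §E The matching stub pins the Abel transform, hence `κ`, across witnesses -/

/-- **S3 pins `κ`.**  If the same finite-chain sequence `F N ν / N` converges to `A₁ ν` and to `A₂ ν` at every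
`ν > 0` (two regular witnesses fed to the matching stub) and `T⁻²·A_i(ν) → κ_i` as `ν ↓ 0`, then `κ₁ = κ₂`.
So stub S3 carries the ∀-witness content "all regular witnesses share their Abel data"; by
`tlconv_kappa_unique` this is forced anyway once a response sequence exists, but S3 asserts it before any
thermodynamic limit is taken. [folklore] -/
theorem matching_pins_kappa (F : ℕ → ℝ → ℝ) (A₁ A₂ : ℝ → ℝ) (T κ₁ κ₂ : ℝ)
    (h₁ : ∀ ν : ℝ, 0 < ν → Tendsto (fun N : ℕ => F N ν / N) atTop (𝓝 (A₁ ν)))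
    (h₂ : ∀ ν : ℝ, 0 < ν → Tendsto (fun N : ℕ => F N ν / N) atTop (𝓝 (A₂ ν)))
    (hκ₁ : Tendsto (fun ν => (T ^ 2)⁻¹ * A₁ ν) (𝓝[>] 0) (𝓝 κ₁))
    (hκ₂ : Tendsto (fun ν => (T ^ 2)⁻¹ * A₂ ν) (𝓝[>] 0) (𝓝 κ₂)) : κ₁ = κ₂ := by
  have hA : ∀ ν : ℝ, 0 < ν → A₁ ν = A₂ ν := fun ν hν => tendsto_nhds_unique (h₁ ν hν) (h₂ ν hν)
  have heq : (fun ν => (T ^ 2)⁻¹ * A₁ ν) =ᶠ[𝓝[>] (0 : ℝ)] fun ν => (T ^ 2)⁻¹ * A₂ ν := by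
    filter_upwards [self_mem_nhdsWithin] with ν hν
    rw [hA ν hν]
  exact tendsto_nhds_unique (hκ₁.congr' heq) hκ₂

end Summit.AtomisticToContinuum.FouriersLaw.Theorems.AbelThermodynamicLimit.Negative

end
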